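import Summits.AtomisticToContinuum.Crystallization.Theorems.FreeSplittingCertificatesStrictSplittingRuleLineTrussInflation
import Summits.AtomisticToContinuum.Crystallization.Theorems.FreeSplittingCertificatesStrictSplittingRuleP1FarShares

/-!
# `StrictSplittingRule` (stmt-AtomisticToContinuum-12560): THE MIDPOINT FORM OF THE LINE-TRUSS TENSION and the far readout shares bounded by it (P1 interpolant object, part 84)

Route `FreeSplittingCertificates`, crux r3 `StrictSplittingRule` (H12⋆ = `stub_coreJointCoercive`), unit b2b-freesplit-B gen 38.
VALUE = the first brick of the (B∃) TAIL LEMMA (HOME CERT §36 (c): "(B∃)'s tail needs the line-truss asymptotics of `p1Beta`").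
The far readout share of a leg is `½β·χ²_mid ≤ ½β⁺` with `β = λ_s·τ`, `τ` the tension of the H1 line truss (part 61).  The far
budget of a cell compares `τ` with the CAPACITY `∫|x|⁻⁶` of the cells around the leg, which sit at the bond's MIDPOINT; the base-site
form `12r⁶τ ≤ 1 + 3(E/r) + …` (`h1_tau_inflation_le`, first order `3E/r`) is too weak there, the midpoint form is second order:
* `inv_cube_tangent` — the tangent inequality of `X ↦ X⁻³`;
* **`h1_tau_midpoint`** — `τ ≤ (1/12)·|v + ½y_s|⁻⁶ + ½|y_s|²·r⁻⁸` for `r = |v| ≥ 12|y_s|`, BOTH orientations (from `h1_tau_asymp2`: the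
  first-order anisotropy `−½W′(r²)⟪v,y_s⟫` IS the shift of `r⁻⁶/12` to the midpoint, by the tangent inequality);
* `h1_tau_midpoint_num` — `τ ≤ (1/12)(1 + 7/500)·|v + ½y_s|⁻⁶` once `r ≥ 36` (`|y_s| ≤ 8/5`);
* `p1Beta_half_le_mid` — the same for the named design: `½β(b_q)(p−q)(s) ≤ (λ_s/24)(507/500)·m⁻⁶`, `m` = distance of the bond midpoint from `y_p`;
* `p1FarW_le_of`, `p1FarWv_le_of` — the pinned far shares are bounded by any nonnegative bound of `½β`.
NOT a proof of H12⋆, NOT summit progress.  [folklore]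
-/

noncomputable section

open Set Function Metric MeasureTheory Filter Topology
open scoped BigOperators NNReal ENNReal Classical

namespace Summit.AtomisticToContinuum.Crystallization.Theorems.StrictSplittingRuleBirth

open Literature.MathematicalPhysics.StatisticalMechanics
open Summit.AtomisticToContinuum.Crystallization.Theorems.PalmUnimodularRigidity.LayeredLawsSelectHcp

/-! ## The tangent inequality of `X ↦ X⁻³` -/

/-- Convexity of `X ↦ X⁻³` on `(0, ∞)`: `R⁻³ − 3R⁻⁴(X − R) ≤ X⁻³` (`R⁴ − 4RX³ + 3X⁴ = (X − R)²(3X² + 2RX + R²) ≥ 0`). [folklore] -/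
theorem inv_cube_tangent {X R : ℝ} (hX : 0 < X) (hR : 0 < R) : (R⁻¹) ^ 3 - 3 * (R⁻¹) ^ 4 * (X - R) ≤ (X⁻¹) ^ 3 := by
  have h1 : (R⁻¹) ^ 3 - 3 * (R⁻¹) ^ 4 * (X - R) = (4 * R - 3 * X) / R ^ 4 := by
    field_simp
    ring
  have h2 : (X⁻¹) ^ 3 = 1 / X ^ 3 := by rw [inv_pow, one_div]
  rw [h1, h2, div_le_div_iff₀ (by positivity) (by positivity)]
  nlinarith [mul_nonneg (sq_nonneg (X - R)) (by positivity : (0 : ℝ) ≤ 3 * X ^ 2 + 2 * R * X + R ^ 2)]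

/-! ## The midpoint form of the tension -/

section Tau4

variable {a h : ℝ} {V : Bool → ℤ × ℤ × ℤ → EuclideanSpace ℝ (Fin 3)} {F : Bool → (ℤ × ℤ × ℤ) → (ℤ × ℤ × ℤ) → ℤ → ℝ}
  {τ : Bool → (ℤ × ℤ × ℤ) → (ℤ × ℤ × ℤ) → ℝ}

/-- **THE MIDPOINT FORM OF THE LINE-TRUSS TENSION, both orientations.**  For `s ∈ Y₁`, `d ≠ 0`, `v = V c d`, `r = ‖v‖ ≥ 12‖y_s‖`:
`τ c s d ≤ (1/12)·(‖v + ½y_s‖²)⁻³ + ½‖y_s‖²·r⁻⁸` — the tension is the isotropic `m⁻⁶/12` at the bond MIDPOINT up to SECOND order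
(`h1_tau_asymp2` + the tangent inequality `(m²)⁻³ ≥ (r²)⁻³ − 3(r²)⁻⁴(m² − r²)`, `m² = r² + ⟪v,y_s⟫ + ¼‖y_s‖²`). [folklore] -/
theorem h1_tau_midpoint (ha : 0 < a) (hh : 0 < h)
    (hV : ∀ c d, V c d = if c = true then hcpSite a h d else -hcpSite a h (-d))
    (hF : ∀ c s d n, F c s d n =
      ljSqDeriv (‖V c (d + n • s)‖ ^ 2) * inner ℝ (V c (d + n • s)) (hcpSite a h s))
    (hτ : ∀ c s d, τ c s d = if 0 ≤ inner ℝ (V c d) (hcpSite a h s) then ∑' m : ℕ, F c s d ((m : ℤ) + 1)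
      else -(F c s d 0 + ∑' m : ℕ, F c s d (-((m : ℤ) + 1))))
    (c : Bool) {s : ℤ × ℤ × ℤ} (hs : s ∈ ({(0, 1, 0), (0, 0, 1), (0, -1, 1), (2, 0, 0)} : Finset (ℤ × ℤ × ℤ)))
    {d : ℤ × ℤ × ℤ} (hd : d ≠ 0) (hr : 12 * ‖hcpSite a h s‖ ≤ ‖V c d‖) :
    τ c s d ≤ 1 / 12 * ((‖V c d + (1 / 2 : ℝ) • hcpSite a h s‖ ^ 2)⁻¹) ^ 3 +
      1 / 2 * ‖hcpSite a h s‖ ^ 2 * (‖V c d‖⁻¹) ^ 8 := by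
  have h2 := h1_tau_asymp2 ha hh hV hF hτ c hs hd
  set e := hcpSite a h s with he_def
  set v := V c d with hv_def
  set r := ‖v‖ with hr_def
  set E := ‖e‖ with hE_def
  set P := inner ℝ v e with hP_def
  have hρ : 0 < min a h := lt_min ha hh
  have hr0 : 0 < r := hρ.trans_le (h1_V_norm_ge ha hh hV c hd)
  have hE0 : 0 ≤ E := norm_nonneg _
  have hPle : P ≤ r * E := real_inner_le_norm v e
  have hPge : -(r * E) ≤ P := by
    have := real_inner_le_norm v (-e)
    rw [inner_neg_right, norm_neg] at this
    linarith
  -- the squared midpoint distance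
  have hm2 : ‖v + (1 / 2 : ℝ) • e‖ ^ 2 = r ^ 2 + P + 1 / 4 * E ^ 2 := by
    rw [h1_line_norm_sq]; ring
  have hm0 : 0 < ‖v + (1 / 2 : ℝ) • e‖ ^ 2 := by
    rw [hm2]; nlinarith
  -- Step 1: the upper bound of `h1_tau_asymp2`
  have hup : τ c s d ≤ -(1 / 2 * lennardJones r) - 1 / 2 * (ljSqDeriv (r ^ 2) * P) +
      (14 + 56 * (r⁻¹) ^ 6) / 32 * (E ^ 2 * (r⁻¹) ^ 8) := by
    have := (abs_le.mp h2).2; linarith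
  -- Step 2: the tangent inequality at `R = r²`, `X = m²`
  have htan := inv_cube_tangent hm0 (by positivity : (0 : ℝ) < r ^ 2)
  rw [hm2] at htan ⊢
  have hid1 : ((r ^ 2)⁻¹) ^ 3 - 3 * ((r ^ 2)⁻¹) ^ 4 * (r ^ 2 + P + 1 / 4 * E ^ 2 - r ^ 2) =
      (r⁻¹) ^ 6 - 3 * (r⁻¹) ^ 8 * P - 3 / 4 * E ^ 2 * (r⁻¹) ^ 8 := by
    rw [inv_pow, inv_pow, ← pow_mul, ← pow_mul, inv_pow, inv_pow]; ring
  rw [hid1] at htan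
  -- Step 3: the junk terms are nonpositive (`12E ≤ r`)
  have hjunk : -(1 / 2 * lennardJones r) - 1 / 2 * (ljSqDeriv (r ^ 2) * P) + (14 + 56 * (r⁻¹) ^ 6) / 32 * (E ^ 2 * (r⁻¹) ^ 8) ≤
      1 / 12 * ((r⁻¹) ^ 6 - 3 * (r⁻¹) ^ 8 * P - 3 / 4 * E ^ 2 * (r⁻¹) ^ 8) + 1 / 2 * E ^ 2 * (r⁻¹) ^ 8 := by
    have hkey : 1 / 4 * P + 7 / 4 * E ^ 2 ≤ r ^ 2 / 24 := by nlinarith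
    have hx0 : 0 ≤ (r⁻¹) ^ 14 := by positivity
    have hm := mul_le_mul_of_nonneg_left hkey hx0
    have hid : -(1 / 2 * lennardJones r) - 1 / 2 * (ljSqDeriv (r ^ 2) * P) + (14 + 56 * (r⁻¹) ^ 6) / 32 * (E ^ 2 * (r⁻¹) ^ 8) -
        (1 / 12 * ((r⁻¹) ^ 6 - 3 * (r⁻¹) ^ 8 * P - 3 / 4 * E ^ 2 * (r⁻¹) ^ 8) + 1 / 2 * E ^ 2 * (r⁻¹) ^ 8) =
        (r⁻¹) ^ 14 * (1 / 4 * P + 7 / 4 * E ^ 2) - (r⁻¹) ^ 14 * (r ^ 2 / 24) := by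
      rw [lennardJones, ljSqDeriv]
      field_simp
      ring
    linarith [hid, hm]
  linarith [hup, hjunk, htan]

/-- **Numerical midpoint form**: for `r = ‖V c d‖ ≥ 36` (and `‖y_s‖ ≤ 8/5`, the certified box): `τ c s d ≤ (1/12)(507/500)·(‖v + ½y_s‖²)⁻³`
(the second-order remainder `6(E/r)²(1 + E/(2r))⁶ ≤ 7/500`). [folklore] -/
theorem h1_tau_midpoint_num (ha : 0 < a) (hh : 0 < h)
    (hV : ∀ c d, V c d = if c = true then hcpSite a h d else -hcpSite a h (-d))
    (hF : ∀ c s d n, F c s d n =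
      ljSqDeriv (‖V c (d + n • s)‖ ^ 2) * inner ℝ (V c (d + n • s)) (hcpSite a h s))
    (hτ : ∀ c s d, τ c s d = if 0 ≤ inner ℝ (V c d) (hcpSite a h s) then ∑' m : ℕ, F c s d ((m : ℤ) + 1)
      else -(F c s d 0 + ∑' m : ℕ, F c s d (-((m : ℤ) + 1))))
    (c : Bool) {s : ℤ × ℤ × ℤ} (hs : s ∈ ({(0, 1, 0), (0, 0, 1), (0, -1, 1), (2, 0, 0)} : Finset (ℤ × ℤ × ℤ)))
    {d : ℤ × ℤ × ℤ} (hd : d ≠ 0) (hys : ‖hcpSite a h s‖ ≤ 8 / 5) (hr : 36 ≤ ‖V c d‖) :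
    τ c s d ≤ 1 / 12 * (507 / 500) * ((‖V c d + (1 / 2 : ℝ) • hcpSite a h s‖ ^ 2)⁻¹) ^ 3 := by
  set e := hcpSite a h s with he_def
  set v := V c d with hv_def
  set r := ‖v‖ with hr_def
  set E := ‖e‖ with hE_def
  have hE0 : 0 ≤ E := norm_nonneg _
  have hr0 : 0 < r := lt_of_lt_of_le (by norm_num) hr
  have h12 : 12 * E ≤ r := by linarith
  have hmid := h1_tau_midpoint ha hh hV hF hτ c hs hd h12
  set P := inner ℝ v e with hP_def
  have hPle : P ≤ r * E := real_inner_le_norm v e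
  have hm2 : ‖v + (1 / 2 : ℝ) • e‖ ^ 2 = r ^ 2 + P + 1 / 4 * E ^ 2 := by
    rw [h1_line_norm_sq]; ring
  have hPge : -(r * E) ≤ P := by
    have := real_inner_le_norm v (-e)
    rw [inner_neg_right, norm_neg] at this
    linarith
  have hm0 : 0 < ‖v + (1 / 2 : ℝ) • e‖ ^ 2 := by rw [hm2]; nlinarith
  -- `m² ≤ (r + E/2)²`, so `E² r⁻⁸ ≤ (7/3000)·(m²)⁻³`
  have hmle : ‖v + (1 / 2 : ℝ) • e‖ ^ 2 ≤ (r + E / 2) ^ 2 := by rw [hm2]; nlinarith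
  have ht : E / r ≤ 2 / 45 := by rw [div_le_iff₀ hr0]; linarith
  have ht0 : 0 ≤ E / r := by positivity
  have hpoly : (E / r) ^ 2 * (1 + E / r / 2) ^ 6 ≤ 7 / 3000 := by
    calc (E / r) ^ 2 * (1 + E / r / 2) ^ 6 ≤ (2 / 45 : ℝ) ^ 2 * (1 + 2 / 45 / 2) ^ 6 := by gcongr
      _ ≤ 7 / 3000 := by norm_num
  -- `E² r⁻⁸ (r + E/2)⁶ ≤ 7/3000`
  have hkey : E ^ 2 * (r⁻¹) ^ 8 * (r + E / 2) ^ 6 ≤ 7 / 3000 := by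
    have hid : E ^ 2 * (r⁻¹) ^ 8 * (r + E / 2) ^ 6 = (E / r) ^ 2 * (1 + E / r / 2) ^ 6 := by
      have hr' : r ≠ 0 := hr0.ne'
      rw [div_eq_mul_inv E r, inv_eq_one_div]
      field_simp
    rw [hid]; exact hpoly
  -- `(m²)³ · (m²)⁻³ = 1`
  have hinv : ((‖v + (1 / 2 : ℝ) • e‖ ^ 2)⁻¹) ^ 3 * (r + E / 2) ^ 6 ≥ 1 := by
    have h3 : (‖v + (1 / 2 : ℝ) • e‖ ^ 2) ^ 3 ≤ ((r + E / 2) ^ 2) ^ 3 := by gcongr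
    have h4 : ((r + E / 2) ^ 2) ^ 3 = (r + E / 2) ^ 6 := by ring
    rw [h4] at h3
    have h5 : ((‖v + (1 / 2 : ℝ) • e‖ ^ 2)⁻¹) ^ 3 * (‖v + (1 / 2 : ℝ) • e‖ ^ 2) ^ 3 = 1 := by
      rw [← mul_pow, inv_mul_cancel₀ hm0.ne', one_pow]
    calc (1 : ℝ) = ((‖v + (1 / 2 : ℝ) • e‖ ^ 2)⁻¹) ^ 3 * (‖v + (1 / 2 : ℝ) • e‖ ^ 2) ^ 3 := h5.symm
      _ ≤ ((‖v + (1 / 2 : ℝ) • e‖ ^ 2)⁻¹) ^ 3 * (r + E / 2) ^ 6 := by gcongr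
  have hX0 : 0 ≤ ((‖v + (1 / 2 : ℝ) • e‖ ^ 2)⁻¹) ^ 3 := by positivity
  have hfin : 1 / 2 * E ^ 2 * (r⁻¹) ^ 8 ≤ 1 / 12 * (7 / 500) * ((‖v + (1 / 2 : ℝ) • e‖ ^ 2)⁻¹) ^ 3 := by
    -- multiply `hkey` by `(m²)⁻³` and use `hinv`
    have h6 := mul_le_mul_of_nonneg_left hkey hX0
    have h7 : 0 ≤ E ^ 2 * (r⁻¹) ^ 8 := by positivity
    nlinarith [mul_le_mul_of_nonneg_left hinv h7]
  linarith [hmid, hfin]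

end Tau4

/-! ## The named design at the midpoint -/

/-- On the box `0 < a ≤ 8/5`, `0 < h ≤ 4/5` every stencil vector has `‖y_s‖ ≤ 8/5` (restated for `p1Stencil`). -/
theorem norm_p1Stencil_le {a h : ℝ} (ha : 0 < a) (hh : 0 < h) (ha' : a ≤ 8 / 5) (hh' : h ≤ 4 / 5) {s : ℤ × ℤ × ℤ}
    (hs : s ∈ p1Stencil) : ‖hcpSite a h s‖ ≤ 8 / 5 :=
  h1_stencil_norm_le_box ha hh ha' hh' (p1Stencil_eq ▸ hs)

/-- **`½β ≤ (λ_s/24)(507/500)·m⁻⁶` for the named line-truss design**: for `s ∈ p1Stencil`, `q ≠ p` with `‖y_q − y_p‖ ≥ 36` (box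
`a ≤ 8/5`, `h ≤ 4/5`), `½·p1Beta(b_q)(p − q)(s) ≤ (p1TrussLam s/24)(507/500)·(m²)⁻³`, `m² = ‖(y_q − y_p) + ½y_s‖²` (bond midpoint seen from `y_p`).
NOT a proof of H12⋆, NOT summit progress. [folklore] -/
theorem p1Beta_half_le_mid {a h : ℝ} (ha : 0 < a) (hh : 0 < h) (ha' : a ≤ 8 / 5) (hh' : h ≤ 4 / 5) (p q : ℤ × ℤ × ℤ)
    {s : ℤ × ℤ × ℤ} (hs : s ∈ p1Stencil) (hqp : q ≠ p) (hr : 36 ≤ ‖hcpSite a h q - hcpSite a h p‖) :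
    1 / 2 * p1Beta a h (decide (Even q.1)) (p - q) s ≤
      p1TrussLam a h s / 24 * (507 / 500) * ((‖(hcpSite a h q - hcpSite a h p) + (1 / 2 : ℝ) • hcpSite a h s‖ ^ 2)⁻¹) ^ 3 := by
  rw [p1Beta_of_mem a h _ _ _ hs]
  have hpar : (if Even (p - q).1 then decide (Even q.1) else !decide (Even q.1)) = decide (Even p.1) := by
    show (if Even (p.1 - q.1) then _ else _) = _
    by_cases hp : Even p.1 <;> by_cases hq : Even q.1 <;> simp [hp, hq, Int.even_sub]
  have hcov : p1TrussV a h (decide (Even p.1)) (q - p) = hcpSite a h q - hcpSite a h p := by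
    have := h1_sub_eq a h p (q - p)
    rw [add_sub_cancel] at this
    rw [this, p1TrussV_eq]
    simp
  have hd : q - p ≠ 0 := sub_ne_zero.2 hqp
  have hys := norm_p1Stencil_le ha hh ha' hh' hs
  have hb := h1_tau_midpoint_num ha hh (p1TrussV_eq a h) (p1TrussF_eq a h) (p1TrussTau_eq a h) (decide (Even p.1))
    (p1Stencil_eq ▸ hs) hd hys (by rw [hcov]; exact hr)
  rw [hcov] at hb
  rw [hpar, neg_sub]
  have hlam : 0 ≤ p1TrussLam a h s := by rw [p1TrussLam_eq]; split_ifs <;> positivity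
  have := mul_le_mul_of_nonneg_left hb hlam
  linarith

/-! ## The pinned far shares are bounded by any bound of `½β` -/

/-- The in-layer far share is at most any nonnegative bound of `½β` on its leg (`χ²_mid ∈ [0,1]`). -/
theorem p1FarW_le_of {a h : ℝ} (φ : Finset ((ℤ × ℤ × ℤ) × (ℤ × ℤ × ℤ))) (p : ℤ × ℤ × ℤ) (e : (ℤ × ℤ × ℤ) × (ℤ × ℤ × ℤ)) {B : ℝ}
    (hB : 0 ≤ B) (hβ : e.1 ≠ p → e.2 ∈ p1StencilIn → 1 / 2 * p1Beta a h (decide (Even e.1.1)) (p - e.1) e.2 ≤ B) :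
    p1FarW a h φ p e ≤ B := by
  unfold p1FarW
  split_ifs with hc
  · obtain ⟨h1, h2, _⟩ := hc
    have hb := hβ h1 h2
    have hχ0 := p1MidChiSq_nonneg a h p e.1 e.2
    have hχ1 := p1MidChiSq_le_one a h p e.1 e.2
    by_cases hsg : 0 ≤ p1Beta a h (decide (Even e.1.1)) (p - e.1) e.2
    · calc 1 / 2 * p1Beta a h (decide (Even e.1.1)) (p - e.1) e.2 * p1MidChiSq a h p e.1 e.2
          ≤ 1 / 2 * p1Beta a h (decide (Even e.1.1)) (p - e.1) e.2 * 1 := by gcongr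
        _ ≤ B := by linarith
    · have hsg' := lt_of_not_ge hsg
      have : 1 / 2 * p1Beta a h (decide (Even e.1.1)) (p - e.1) e.2 * p1MidChiSq a h p e.1 e.2 ≤ 0 :=
        mul_nonpos_of_nonpos_of_nonneg (by linarith) hχ0
      linarith
  · exact hB

/-- The vertical far share is at most any nonnegative bound of `½β` on its bond (`χ²_mid ∈ [0,1]`). -/
theorem p1FarWv_le_of {a h : ℝ} (φ : Finset ((ℤ × ℤ × ℤ) × (ℤ × ℤ × ℤ))) (p q : ℤ × ℤ × ℤ) {B : ℝ}
    (hB : 0 ≤ B) (hβ : q ≠ p → 1 / 2 * p1Beta a h (decide (Even q.1)) (p - q) p1SV ≤ B) :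
    p1FarWv a h φ p q ≤ B := by
  unfold p1FarWv
  split_ifs with hc
  · obtain ⟨h1, _⟩ := hc
    have hb := hβ h1
    have hχ0 := p1MidChiSq_nonneg a h p q p1SV
    have hχ1 := p1MidChiSq_le_one a h p q p1SV
    by_cases hsg : 0 ≤ p1Beta a h (decide (Even q.1)) (p - q) p1SV
    · calc 1 / 2 * p1Beta a h (decide (Even q.1)) (p - q) p1SV * p1MidChiSq a h p q p1SV
          ≤ 1 / 2 * p1Beta a h (decide (Even q.1)) (p - q) p1SV * 1 := by gcongr
        _ ≤ B := by linarith
    · have hsg' := lt_of_not_ge hsg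
      have : 1 / 2 * p1Beta a h (decide (Even q.1)) (p - q) p1SV * p1MidChiSq a h p q p1SV ≤ 0 :=
        mul_nonpos_of_nonpos_of_nonneg (by linarith) hχ0
      linarith
  · exact hB

/-- **The far shares bounded at the midpoint**: for a stencil leg `(q, s)` with `q ≠ p`, `‖y_q − y_p‖ ≥ 36` (box `a ≤ 8/5`, `h ≤ 4/5`):
`p1FarW φ p (q,s) ≤ (p1TrussLam s/24)(507/500)·(m²)⁻³` and, for `s = (2,0,0)`, `p1FarWv φ p q ≤ …` likewise. [folklore] -/
theorem p1FarW_le_mid {a h : ℝ} (ha : 0 < a) (hh : 0 < h) (ha' : a ≤ 8 / 5) (hh' : h ≤ 4 / 5)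
    (φ : Finset ((ℤ × ℤ × ℤ) × (ℤ × ℤ × ℤ))) (p q s : ℤ × ℤ × ℤ) (hs : s ∈ p1Stencil) (hqp : q ≠ p)
    (hr : 36 ≤ ‖hcpSite a h q - hcpSite a h p‖) :
    p1FarW a h φ p (q, s) ≤
      p1TrussLam a h s / 24 * (507 / 500) * ((‖(hcpSite a h q - hcpSite a h p) + (1 / 2 : ℝ) • hcpSite a h s‖ ^ 2)⁻¹) ^ 3 := by
  have hlam : 0 ≤ p1TrussLam a h s := by rw [p1TrussLam_eq]; split_ifs <;> positivity
  exact p1FarW_le_of φ p (q, s) (by positivity) fun _ _ => p1Beta_half_le_mid ha hh ha' hh' p q hs hqp hr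

/-- The vertical share at the midpoint (`s = p1SV`). [folklore] -/
theorem p1FarWv_le_mid {a h : ℝ} (ha : 0 < a) (hh : 0 < h) (ha' : a ≤ 8 / 5) (hh' : h ≤ 4 / 5)
    (φ : Finset ((ℤ × ℤ × ℤ) × (ℤ × ℤ × ℤ))) (p q : ℤ × ℤ × ℤ) (hqp : q ≠ p) (hr : 36 ≤ ‖hcpSite a h q - hcpSite a h p‖) :
    p1FarWv a h φ p q ≤
      p1TrussLam a h p1SV / 24 * (507 / 500) * ((‖(hcpSite a h q - hcpSite a h p) + (1 / 2 : ℝ) • hcpSite a h p1SV‖ ^ 2)⁻¹) ^ 3 := by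
  have hlam : 0 ≤ p1TrussLam a h p1SV := by rw [p1TrussLam_eq]; split_ifs <;> positivity
  exact p1FarWv_le_of φ p q (by positivity) fun _ => p1Beta_half_le_mid ha hh ha' hh' p q p1SV_mem hqp hr

end Summit.AtomisticToContinuum.Crystallization.Theorems.StrictSplittingRuleBirth

end
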